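import Summits.BirchSwinnertonDyer.BirchSwinnertonDyer.Theorems.ErratumRoadFiveKatoFframeKummerUnramifiedBadA
import Summits.BirchSwinnertonDyer.Rank1Residual.Additive.KatoDescentKummerUnramifiedMordellWeil
import HarnessLib

set_option autoImplicit false

/-!
# Route `ErratumRoadFive`, crux 19715 `EulerHalfNotRamNoInertSetAtFive`, line `kato_Fframe` (r5.4), stub S1Λ
# `stub_katoLambdaLogBoundTamagawa` — HELPER R-C re-thread B: Part 27 of cell bsd-cm with `hQadd` replaced by the LOCAL BINDERS
# (I) (local index) and (L) (door lift)

Seat `bsd-line-er5-p1` (LEAD g9), `--supports stmt-BirchSwinnertonDyer-19715` (helper). Theorems only: no definition, no named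
fact, no instance, no notation, no `sorry`. `K : Type`. No summit statement is proved here; BSD is proved for no curve.

Continues `…KummerUnramifiedBadA` (Parts 24 §3 / 25 / 26 re-threaded).  Here:

* §1 (Part 27′) `localization_mem_unramifiedSubgroup_of_mem_selmerLocalKerPrimary_of_not_mem` — GENERAL (no reduction hypothesis): the
  `p^∞`-Selmer local kernel at `v ∤ p` is unramified, indeed ZERO on `E[p^∞]`: `x = ι_{k+1} y` with `loc_v y ∈ 𝓚_v = ker ι_{k+1,v}` (X11b
  `kummerLocalConditionAt_eq_ker_map_primaryInclusion`); `selmerGroupPInfty_le_of_mem_iff_of_not_mem` (`Sel_{p^∞} ≤ S_Σ`);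
  `exists_forall_le_relIndex_selmerGroupPInfty_eq_and_mul_eq_of_local`, `exists_addSubgroup_selmerGroupPInfty_le_and_relIndex_mul_eq_of_local`
  (Part 27 §2 verbatim with binders (I), (L)).
* (Part 29′ with binder (E) is `…KummerUnramifiedBadC`.)

References: [Rubin2000] Thm. 1.7.3; [Kato2004Asterisque] §14.1 (p. 235), §14.8 (p. 238), (14.9.3) (p. 240); [GreenbergLNM1716] §2, §5
(p. 114); [MilneADT2006] Ch. I Prop. 3.8, Thm. 4.10; [SilvermanAEC2009] VII.3.1, VII.6, VIII.§2.
-/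

noncomputable section

open scoped Classical ContRepresentation NumberField
open Function Field NumberField IsDedekindDomain WeierstrassCurve
open Literature.NumberTheory.EllipticCurves Literature.NumberTheory.GaloisRepresentations
  Literature.NumberTheory.GaloisRepresentations.DiscreteGaloisModule Literature.NumberTheory.GaloisCohomology
open Summit.BirchSwinnertonDyer.Rank1Residual.X11b.Levels Summit.BirchSwinnertonDyer.Rank1Residual.X11b.LocBridge
open Summit.BirchSwinnertonDyer.Rank1Residual.GaloisImage
open Summit.BirchSwinnertonDyer.Rank1Residual.Additive.LevelBridge
open Summit.BirchSwinnertonDyer.Rank1Residual.Additive.KummerUnramified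

set_option linter.dupNamespace false

namespace Summit.BirchSwinnertonDyer.BirchSwinnertonDyer.Theorems.ErratumRoadFiveKatoFframeKummerUnramifiedBad

variable {K : Type} [Field K] [NumberField K] (W : WeierstrassCurve K) [W.IsElliptic] (p : ℕ) [hp : Fact p.Prime]

/-! ## §1 Part 27′: `Sel_{p^∞} ≤ S_Σ` at any `Σ ∌ v ∣ p`, and the discrete-side product for `k ≫ 0` -/

/-- **At a finite `v ∤ p` the `p^∞`-Selmer local kernel is unramified (indeed zero)** — no reduction hypothesis: write `x = ι_{k+1} y`;
`y` is Kummer at `v`, and `𝓚_v = ker ι_{k+1,v}` (X11b `kummerLocalConditionAt_eq_ker_map_primaryInclusion`), so `loc_v x = ι_{k+1,v}(loc_v y) = 0`.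
[cite: GreenbergLNM1716, §2 (pp. 72–74)] [cite: MilneADT2006, Ch. I, Lemma 3.3 and Prop. 3.8] -/
theorem localization_mem_unramifiedSubgroup_of_mem_selmerLocalKerPrimary_of_not_mem
    (v : HeightOneSpectrum (𝓞 K)) (hpv : ((p : ℕ) : 𝓞 K) ∉ v.asIdeal)
    (x : W.galH1Primary p) (hx : x ∈ selmerLocalKerPrimary W (v.adicCompletion K) p) :
    galoisCohomology.localization (primaryGaloisModule W p) (Sum.inr v) 1 x ∈
      unramifiedSubgroup (GaloisRep.toLocal v (primaryGaloisModule W p)) 1 := by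
  obtain ⟨k, hk⟩ := exists_mem_range_map_primaryInclusion W p x
  obtain ⟨y, rfl⟩ := monotone_range_map_primaryInclusion W p (Nat.le_succ k) hk
  have hn : ((p ^ (k + 1) : ℕ) : ℤ) ≠ 0 := by exact_mod_cast pow_ne_zero (k + 1) hp.out.ne_zero
  have hy : y ∈ selmerLocalKer W (v.adicCompletion K) ((p ^ (k + 1) : ℕ) : ℤ) :=
    (map_primaryInclusion_mem_selmerLocalKerPrimary_iff W p (k + 1) _ y).1 hx
  have hloc : galoisCohomology.localization (W.torsionGaloisModule ((p ^ (k + 1) : ℕ) : ℤ)) (Sum.inr v) 1 y ∈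
      W.kummerSelmerStructure ((p ^ (k + 1) : ℕ) : ℤ) (Sum.inr v) :=
    AddSubgroup.mem_comap.1
      ((SetLike.ext_iff.mp (W.comap_localization_kummerSelmerStructure ((p ^ (k + 1) : ℕ) : ℤ) (Sum.inr v)) y).2 hy)
  have hker : galoisCohomology.map ((primaryInclusion W p (k + 1)).restrictField (v.adicCompletion K)) 1
      (galoisCohomology.localization (W.torsionGaloisModule ((p ^ (k + 1) : ℕ) : ℤ)) (Sum.inr v) 1 y) = 0 := by
    have e : W.kummerSelmerStructure ((p ^ (k + 1) : ℕ) : ℤ) (Sum.inr v) =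
        (galoisCohomology.map ((primaryInclusion W p (k + 1)).restrictField (v.adicCompletion K)) 1).ker :=
      Summit.BirchSwinnertonDyer.Rank1Residual.X11b.LevelKummer.kummerLocalConditionAt_eq_ker_map_primaryInclusion W p (k + 1) v
        hpv hn
    rw [e] at hloc
    exact hloc
  rw [localization_map_one']
  change galoisCohomology.map ((primaryInclusion W p (k + 1)).restrictField (v.adicCompletion K)) 1
      (galoisCohomology.localization (W.torsionGaloisModule ((p ^ (k + 1) : ℕ) : ℤ)) (Sum.inr v) 1 y) ∈ _
  rw [hker]
  exact zero_mem _

omit [W.IsElliptic] in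
/-- **`Sel_{p^∞}(E/K) ≤ S_Σ`** for every finite set `Σ` of finite places `∤ p` (no reduction hypothesis).
[cite: Kato2004Asterisque, §14.8 (p. 238)] -/
theorem selmerGroupPInfty_le_of_mem_iff_of_not_mem [W.IsElliptic] (Q : Finset (HeightOneSpectrum (𝓞 K)))
    (hQp : ∀ v ∈ Q, ((p : ℕ) : 𝓞 K) ∉ v.asIdeal)
    (S : AddSubgroup (W.galH1Primary p))
    (hS : ∀ x, x ∈ S ↔
      (∀ v : HeightOneSpectrum (𝓞 K), v ∉ Q → x ∈ selmerLocalKerPrimary W (v.adicCompletion K) p) ∧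
      (∀ w : InfinitePlace K, x ∈ selmerLocalKerPrimary W w.Completion p) ∧
      (∀ v ∈ Q, galoisCohomology.localization (primaryGaloisModule W p) (Sum.inr v) 1 x ∈
        unramifiedSubgroup (GaloisRep.toLocal v (primaryGaloisModule W p)) 1)) :
    selmerGroupPInfty W p ≤ S := by
  intro x hx
  have hx' : (x ∈ ⨅ v : HeightOneSpectrum (𝓞 K), selmerLocalKerPrimary W (v.adicCompletion K) p) ∧
      x ∈ ⨅ w : InfinitePlace K, selmerLocalKerPrimary W w.Completion p := hx
  rw [AddSubgroup.mem_iInf, AddSubgroup.mem_iInf] at hx'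
  exact (hS x).2 ⟨fun v _ => hx'.1 v, hx'.2, fun v hv =>
    localization_mem_unramifiedSubgroup_of_mem_selmerLocalKerPrimary_of_not_mem W p v (hQp v hv) x (hx'.1 v)⟩

/-- **(R1-d), discrete side, reduction-type-free at `Σ`: `[S_Σ : Sel_{p^∞} ⊓ S_Σ]` is finite, is reached at a finite level, and
`[S_Σ : Sel_{p^∞} ⊓ S_Σ] · [Sel^{(p^k)}(E/K) : H¹_{𝓚⊓ur@Σ}(K, E[p^k])] = ∏_{v∈Σ} p^{v_p(c_v)}` for all large `k`.**  Part 27 §2 verbatim with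
binders (I) and (L) in place of additivity. [cite: Rubin2000, Thm. 1.7.3] [cite: Kato2004Asterisque, §14.8 (p. 238) and (14.9.3) (p. 240)]
[cite: GreenbergLNM1716, §5 (p. 114)] -/
theorem exists_forall_le_relIndex_selmerGroupPInfty_eq_and_mul_eq_of_local (hodd : p ≠ 2)
    (Q T : Finset (HeightOneSpectrum (𝓞 K))) (hQT : Q ⊆ T)
    (hQp : ∀ v ∈ Q, ((p : ℕ) : 𝓞 K) ∉ v.asIdeal)
    (hidx : ∀ v ∈ Q, ∃ k₁ : ℕ, ∀ k, k₁ ≤ k →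
      (W.kummerSelmerStructure ((p ^ k : ℕ) : ℤ) (Sum.inr v)).relIndex
          (W.kummerSelmerStructure ((p ^ k : ℕ) : ℤ) (Sum.inr v) ⊔
            unramifiedSubgroup (GaloisRep.toLocal v (W.torsionGaloisModule ((p ^ k : ℕ) : ℤ))) 1) =
        p ^ padicValNat p ((W.baseChange (v.adicCompletion K)).localTamagawaNumber (v.adicCompletionIntegers K)))
    (hlift : ∀ v ∈ Q, ∃ k₂ : ℕ, ∀ k, k₂ ≤ k → ∀ y : W.geomPrimaryTorsion p,
      (∀ τ ∈ absInertia (v.adicCompletion K),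
        GaloisRep.restrictField (v.adicCompletion K) (primaryGaloisModule W p) τ y = y) →
      (∀ σ : absoluteGaloisGroup (v.adicCompletion K), ∃ z : W.geomPrimaryTorsion p,
        (∀ τ ∈ absInertia (v.adicCompletion K),
          GaloisRep.restrictField (v.adicCompletion K) (primaryGaloisModule W p) τ z = z) ∧
        GaloisRep.restrictField (v.adicCompletion K) (primaryGaloisModule W p) σ y - y = p ^ k • z) →
      ∃ m : W.geomPrimaryTorsion p,
        (∀ σ : absoluteGaloisGroup (v.adicCompletion K),
          GaloisRep.restrictField (v.adicCompletion K) (primaryGaloisModule W p) σ m = m) ∧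
        ∃ z : W.geomPrimaryTorsion p,
          (∀ τ ∈ absInertia (v.adicCompletion K),
            GaloisRep.restrictField (v.adicCompletion K) (primaryGaloisModule W p) τ z = z) ∧
          y - m = p ^ k • z)
    (hTp : ∀ v : HeightOneSpectrum (𝓞 K), ((p : ℕ) : 𝓞 K) ∈ v.asIdeal → v ∈ T)
    (hTbad : ∀ v : HeightOneSpectrum (𝓞 K), ¬ W.HasGoodReductionAt v → v ∈ T)
    (S : AddSubgroup (W.galH1Primary p))
    (hS : ∀ x, x ∈ S ↔
      (∀ v : HeightOneSpectrum (𝓞 K), v ∉ Q → x ∈ selmerLocalKerPrimary W (v.adicCompletion K) p) ∧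
      (∀ w : InfinitePlace K, x ∈ selmerLocalKerPrimary W w.Completion p) ∧
      (∀ v ∈ Q, galoisCohomology.localization (primaryGaloisModule W p) (Sum.inr v) 1 x ∈
        unramifiedSubgroup (GaloisRep.toLocal v (primaryGaloisModule W p)) 1)) :
    (selmerGroupPInfty W p).relIndex S ≠ 0 ∧
    (selmerGroupPInfty W p).relIndex S ≤
      ∏ v ∈ Q, p ^ padicValNat p ((W.baseChange (v.adicCompletion K)).localTamagawaNumber (v.adicCompletionIntegers K)) ∧
    ∃ k₀ : ℕ, 1 ≤ k₀ ∧ ∀ k, k₀ ≤ k →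
      (selmerGroupPInfty W p).relIndex (S ⊓ (galoisCohomology.map (primaryInclusion W p k) 1 : galH1Torsion W ((p ^ k : ℕ) : ℤ) →+ W.galH1Primary p).range) =
        (selmerGroupPInfty W p).relIndex S ∧
      ∀ (𝓖' : SelmerStructure (W.torsionGaloisModule ((p ^ k : ℕ) : ℤ))),
        (∀ v ∈ Q, 𝓖' (Sum.inr v) = W.kummerSelmerStructure ((p ^ k : ℕ) : ℤ) (Sum.inr v) ⊓
          unramifiedSubgroup (GaloisRep.toLocal v (W.torsionGaloisModule ((p ^ k : ℕ) : ℤ))) 1) →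
        (∀ v ∉ Q, 𝓖' (Sum.inr v) = W.kummerSelmerStructure ((p ^ k : ℕ) : ℤ) (Sum.inr v)) →
        (∀ w : InfinitePlace K, 𝓖' (Sum.inl w) = W.kummerSelmerStructure ((p ^ k : ℕ) : ℤ) (Sum.inl w)) →
        (selmerGroupPInfty W p).relIndex S *
            𝓖'.selmerGroup.relIndex (W.kummerSelmerStructure ((p ^ k : ℕ) : ℤ)).selmerGroup =
          ∏ v ∈ Q, p ^ padicValNat p
            ((W.baseChange (v.adicCompletion K)).localTamagawaNumber (v.adicCompletionIntegers K)) := by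
  classical
  set C := ∏ v ∈ Q, p ^ padicValNat p
    ((W.baseChange (v.adicCompletion K)).localTamagawaNumber (v.adicCompletionIntegers K)) with hCdef
  have hCpos : 0 < C := Finset.prod_pos fun v _ => pow_pos hp.out.pos _
  obtain ⟨k₁, hk₁, h⟩ := exists_forall_le_relIndex_selmerGroupPInfty_mul_relIndex_eq_of_local W p hodd Q T hQT hQp hidx hlift
    hTp hTbad S hS
  -- the two canonical structures at level `p^k`
  let 𝓖₀ : ∀ k : ℕ, SelmerStructure (W.torsionGaloisModule ((p ^ k : ℕ) : ℤ)) := fun k u =>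
    match u with
    | Sum.inl w => W.kummerSelmerStructure ((p ^ k : ℕ) : ℤ) (Sum.inl w)
    | Sum.inr v => if v ∈ Q then W.kummerSelmerStructure ((p ^ k : ℕ) : ℤ) (Sum.inr v) ⊔
        unramifiedSubgroup (GaloisRep.toLocal v (W.torsionGaloisModule ((p ^ k : ℕ) : ℤ))) 1
        else W.kummerSelmerStructure ((p ^ k : ℕ) : ℤ) (Sum.inr v)
  let 𝓖₀' : ∀ k : ℕ, SelmerStructure (W.torsionGaloisModule ((p ^ k : ℕ) : ℤ)) := fun k u =>
    match u with
    | Sum.inl w => W.kummerSelmerStructure ((p ^ k : ℕ) : ℤ) (Sum.inl w)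
    | Sum.inr v => if v ∈ Q then W.kummerSelmerStructure ((p ^ k : ℕ) : ℤ) (Sum.inr v) ⊓
        unramifiedSubgroup (GaloisRep.toLocal v (W.torsionGaloisModule ((p ^ k : ℕ) : ℤ))) 1
        else W.kummerSelmerStructure ((p ^ k : ℕ) : ℤ) (Sum.inr v)
  have h𝓖₀Q : ∀ k, ∀ v ∈ Q, 𝓖₀ k (Sum.inr v) = W.kummerSelmerStructure ((p ^ k : ℕ) : ℤ) (Sum.inr v) ⊔
      unramifiedSubgroup (GaloisRep.toLocal v (W.torsionGaloisModule ((p ^ k : ℕ) : ℤ))) 1 := fun k v hv => by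
    change (if v ∈ Q then _ else _) = _; rw [if_pos hv]
  have h𝓖₀nQ : ∀ k, ∀ v ∉ Q, 𝓖₀ k (Sum.inr v) = W.kummerSelmerStructure ((p ^ k : ℕ) : ℤ) (Sum.inr v) :=
    fun k v hv => by change (if v ∈ Q then _ else _) = _; rw [if_neg hv]
  have h𝓖₀'Q : ∀ k, ∀ v ∈ Q, 𝓖₀' k (Sum.inr v) = W.kummerSelmerStructure ((p ^ k : ℕ) : ℤ) (Sum.inr v) ⊓
      unramifiedSubgroup (GaloisRep.toLocal v (W.torsionGaloisModule ((p ^ k : ℕ) : ℤ))) 1 := fun k v hv => by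
    change (if v ∈ Q then _ else _) = _; rw [if_pos hv]
  have h𝓖₀'nQ : ∀ k, ∀ v ∉ Q, 𝓖₀' k (Sum.inr v) = W.kummerSelmerStructure ((p ^ k : ℕ) : ℤ) (Sum.inr v) :=
    fun k v hv => by change (if v ∈ Q then _ else _) = _; rw [if_neg hv]
  -- the bound `[S ⊓ im ι_k : Sel_{p^∞} ⊓ …] ∣ C` for `k ≥ k₁`
  have hbound : ∀ k, k₁ ≤ k →
      (selmerGroupPInfty W p).relIndex (S ⊓ (galoisCohomology.map (primaryInclusion W p k) 1 : galH1Torsion W ((p ^ k : ℕ) : ℤ) →+ W.galH1Primary p).range) ≠ 0 ∧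
      (selmerGroupPInfty W p).relIndex (S ⊓ (galoisCohomology.map (primaryInclusion W p k) 1 : galH1Torsion W ((p ^ k : ℕ) : ℤ) →+ W.galH1Primary p).range) ≤ C := by
    intro k hk
    obtain ⟨-, hmul⟩ := h k hk (𝓖₀ k) (𝓖₀' k) (h𝓖₀Q k) (h𝓖₀nQ k) (fun w => rfl) (h𝓖₀'Q k) (h𝓖₀'nQ k) (fun w => rfl)
    have hdvd : (selmerGroupPInfty W p).relIndex (S ⊓ (galoisCohomology.map (primaryInclusion W p k) 1 : galH1Torsion W ((p ^ k : ℕ) : ℤ) →+ W.galH1Primary p).range) ∣ C :=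
      Dvd.intro _ hmul
    refine ⟨fun h0 => ?_, Nat.le_of_dvd hCpos hdvd⟩
    rw [h0, zero_mul] at hmul
    exact hCpos.ne' hmul.symm
  obtain ⟨hne, hle, k₂, hk₂⟩ := relIndex_ne_zero_and_exists_forall_le_relIndex_inf_eq S (selmerGroupPInfty W p)
    (fun k => (galoisCohomology.map (primaryInclusion W p k) 1 : galH1Torsion W ((p ^ k : ℕ) : ℤ) →+ W.galH1Primary p).range) (monotone_range_map_primaryInclusion W p)
    (exists_mem_range_map_primaryInclusion W p) C k₁ hbound
  refine ⟨hne, hle, max k₁ k₂, le_trans hk₁ (le_max_left _ _), fun k hk => ⟨hk₂ k ((le_max_right _ _).trans hk), ?_⟩⟩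
  intro 𝓖' h𝓖'Q h𝓖'nQ h𝓖'inl
  obtain ⟨-, hmul⟩ := h k ((le_max_left _ _).trans hk) (𝓖₀ k) 𝓖' (h𝓖₀Q k) (h𝓖₀nQ k) (fun w => rfl) h𝓖'Q h𝓖'nQ
    h𝓖'inl
  rw [← hk₂ k ((le_max_right _ _).trans hk)]
  exact hmul

/-- **(R1-d), DISCRETE SIDE, SELF-CONTAINED, reduction-type-free at `Σ`** (no free `S`): with THE subgroup `S_Σ` «`p^∞`-Selmer local kernel
off `Σ`, unramified at `Σ`» (Kato's `S(T)`), `Sel_{p^∞} ≤ S_Σ`, `[S_Σ : Sel_{p^∞}]` finite, and for `k ≫ 0` and every `𝓖'` «`𝓚 ⊓ H¹_ur` at `Σ`,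
`𝓚` elsewhere»: `[S_Σ : Sel_{p^∞}] · [Sel^{(p^k)} : H¹_{𝓖'}] = ∏_{v∈Σ} p^{v_p(c_v)}`. Part 27 verbatim with binders (I), (L).
[cite: Kato2004Asterisque, §14.8 (p. 238) and (14.9.3) (p. 240)] [cite: Rubin2000, Thm. 1.7.3] [cite: GreenbergLNM1716, §5 (p. 114)] -/
theorem exists_addSubgroup_selmerGroupPInfty_le_and_relIndex_mul_eq_of_local (hodd : p ≠ 2)
    (Q T : Finset (HeightOneSpectrum (𝓞 K))) (hQT : Q ⊆ T)
    (hQp : ∀ v ∈ Q, ((p : ℕ) : 𝓞 K) ∉ v.asIdeal)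
    (hidx : ∀ v ∈ Q, ∃ k₁ : ℕ, ∀ k, k₁ ≤ k →
      (W.kummerSelmerStructure ((p ^ k : ℕ) : ℤ) (Sum.inr v)).relIndex
          (W.kummerSelmerStructure ((p ^ k : ℕ) : ℤ) (Sum.inr v) ⊔
            unramifiedSubgroup (GaloisRep.toLocal v (W.torsionGaloisModule ((p ^ k : ℕ) : ℤ))) 1) =
        p ^ padicValNat p ((W.baseChange (v.adicCompletion K)).localTamagawaNumber (v.adicCompletionIntegers K)))
    (hlift : ∀ v ∈ Q, ∃ k₂ : ℕ, ∀ k, k₂ ≤ k → ∀ y : W.geomPrimaryTorsion p,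
      (∀ τ ∈ absInertia (v.adicCompletion K),
        GaloisRep.restrictField (v.adicCompletion K) (primaryGaloisModule W p) τ y = y) →
      (∀ σ : absoluteGaloisGroup (v.adicCompletion K), ∃ z : W.geomPrimaryTorsion p,
        (∀ τ ∈ absInertia (v.adicCompletion K),
          GaloisRep.restrictField (v.adicCompletion K) (primaryGaloisModule W p) τ z = z) ∧
        GaloisRep.restrictField (v.adicCompletion K) (primaryGaloisModule W p) σ y - y = p ^ k • z) →
      ∃ m : W.geomPrimaryTorsion p,
        (∀ σ : absoluteGaloisGroup (v.adicCompletion K),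
          GaloisRep.restrictField (v.adicCompletion K) (primaryGaloisModule W p) σ m = m) ∧
        ∃ z : W.geomPrimaryTorsion p,
          (∀ τ ∈ absInertia (v.adicCompletion K),
            GaloisRep.restrictField (v.adicCompletion K) (primaryGaloisModule W p) τ z = z) ∧
          y - m = p ^ k • z)
    (hTp : ∀ v : HeightOneSpectrum (𝓞 K), ((p : ℕ) : 𝓞 K) ∈ v.asIdeal → v ∈ T)
    (hTbad : ∀ v : HeightOneSpectrum (𝓞 K), ¬ W.HasGoodReductionAt v → v ∈ T) :
    ∃ S : AddSubgroup (W.galH1Primary p),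
      (∀ x, x ∈ S ↔
        (∀ v : HeightOneSpectrum (𝓞 K), v ∉ Q → x ∈ selmerLocalKerPrimary W (v.adicCompletion K) p) ∧
        (∀ w : InfinitePlace K, x ∈ selmerLocalKerPrimary W w.Completion p) ∧
        (∀ v ∈ Q, galoisCohomology.localization (primaryGaloisModule W p) (Sum.inr v) 1 x ∈
          unramifiedSubgroup (GaloisRep.toLocal v (primaryGaloisModule W p)) 1)) ∧
      selmerGroupPInfty W p ≤ S ∧ (selmerGroupPInfty W p).relIndex S ≠ 0 ∧
      ∃ k₀ : ℕ, 1 ≤ k₀ ∧ ∀ k, k₀ ≤ k →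
        ∀ (𝓖' : SelmerStructure (W.torsionGaloisModule ((p ^ k : ℕ) : ℤ))),
          (∀ v ∈ Q, 𝓖' (Sum.inr v) = W.kummerSelmerStructure ((p ^ k : ℕ) : ℤ) (Sum.inr v) ⊓
            unramifiedSubgroup (GaloisRep.toLocal v (W.torsionGaloisModule ((p ^ k : ℕ) : ℤ))) 1) →
          (∀ v ∉ Q, 𝓖' (Sum.inr v) = W.kummerSelmerStructure ((p ^ k : ℕ) : ℤ) (Sum.inr v)) →
          (∀ w : InfinitePlace K, 𝓖' (Sum.inl w) = W.kummerSelmerStructure ((p ^ k : ℕ) : ℤ) (Sum.inl w)) →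
          (selmerGroupPInfty W p).relIndex S *
              𝓖'.selmerGroup.relIndex (W.kummerSelmerStructure ((p ^ k : ℕ) : ℤ)).selmerGroup =
            ∏ v ∈ Q, p ^ padicValNat p
              ((W.baseChange (v.adicCompletion K)).localTamagawaNumber (v.adicCompletionIntegers K)) := by
  obtain ⟨S, hS, -⟩ := existsUnique_addSubgroup_mem_iff W p Q
  obtain ⟨hne, -, k₀, hk₀, h⟩ :=
    exists_forall_le_relIndex_selmerGroupPInfty_eq_and_mul_eq_of_local W p hodd Q T hQT hQp hidx hlift hTp hTbad S hS
  exact ⟨S, hS, selmerGroupPInfty_le_of_mem_iff_of_not_mem W p Q hQp S hS, hne, k₀, hk₀,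
    fun k hk 𝓖' h₁ h₂ h₃ => (h k hk).2 𝓖' h₁ h₂ h₃⟩

end Summit.BirchSwinnertonDyer.BirchSwinnertonDyer.Theorems.ErratumRoadFiveKatoFframeKummerUnramifiedBad

end
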